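import Literature.Probability.RandomMatrixProducts.AndersonModel1DEstimates
import Mathlib.MeasureTheory.Integral.Prod
import Mathlib.Analysis.SpecialFunctions.Log.Basic
import HarnessLib

/-!
# Uniform growth of vectors from positivity of the Lyapunov exponent (two-step direction smoothing)

Companion to `AndersonModel1D.lean` / `AndersonModel1DEstimates.lean` (transfer matrices
`M^E(α) = [[E - α, -1],[1, 0]]` of the one-dimensional Anderson model, Bucaj–Damanik–Fillman–
Gerbuz–VandenBoom–Wang–Zhang, TAMS **372** (2019), arXiv:1706.06135, §§2–3).  Everything here is
PROVED.

The vendored localisation input of that file enters transport bounds only through the following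
"pointwise core": a scale `N` with `𝔼 log ‖M_N v‖ ≥ 2` for EVERY unit vector `v`.  In
`DisorderedHarmonicChainFurstenberg.lean` this was obtained from Fürstenberg positivity
(`BucajEtAl2019_lyapunovPos`, Thm 2.3) AND the vectorwise uniform large-deviation theorem
(`BucajEtAl2019_vectorLDT`, Prop. 3.6).  This file shows that, for single-site laws with a
BOUNDED DENSITY and compact support, positivity ALONE suffices, by an elementary argument:

* `𝔼 log ‖M_n‖ ≥ n L` for every `n ≥ 1` is immediate from the definition of the Lyapunov exponent
  `L = inf_n n⁻¹ 𝔼 log ‖M_n‖` (`andersonLyapunov`), once `‖M_n‖ ≥ 1` (`det = 1`) makes the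
  averages non-negative (`andersonLyapunov_le_logNormAvg`).
* Split `M_{2+q} v = M'(B v)` with `B` the first two steps and `M'` the remaining `q` steps
  (independent).  If some row `r_i` of `M'` sees the direction of `w = Bv` at angle
  `(r_i · ŵ)² ≥ θ² F²/2` (`F` the Frobenius norm), then `‖M' w‖ ≥ θ ‖M'‖ ‖w‖ / √2`; otherwise the
  direction `ŵ` is `θ`-orthogonal to the (normalised) longer row of `M'`.
* **Two-step smoothing** (`pi_two_measure_dot_lt_le`): for unit `v, s` the functional
  `⟨s, M_2(x₀,x₁) v⟩ = u₀ (s₀(E - x₁) + s₁) - s₀ v₀`, `u₀ = (E - x₀)v₀ - v₁`, is affine in `x₁`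
  with slope `-s₀u₀` and `u₀` is affine in `x₀` with slope `-v₀`; a three-way case analysis gives
  `ℙ(|⟨s, M_2 v⟩| < η³) ≤ C₁ η`, uniformly in `v, s`, with `C₁ = 2K + 24K(1 + |E| + R)` for a law
  with `μ[p,q] ≤ K(q-p)` supported in `[-R, R]`.
* Hence `𝔼 log‖M_{2+q} v‖ ≥ qL - 4 log(D+1) + 3 log η - log √2 - 2 q log(D+1) C₁ η`
  (`integral_log_norm_apply_ge`), `D = |E| + R`, and choosing `η ~ 1/q` and `q` large,
  `𝔼 log ‖M_N v‖ ≥ 2` for all unit `v` (`exists_scale_logMoment_ge_two`).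

This is the classical remark that for absolutely continuous site distributions no large-deviation
or uniqueness-of-stationary-measure input is needed to pass from the Lyapunov exponent of the
matrices to uniform growth of every vector in expectation. [folklore]
-/

noncomputable section

open MeasureTheory Set
open scoped Matrix.Norms.L2Operator Matrix ENNReal

namespace Literature.Probability.RandomMatrixProducts

/-! ### Two-dimensional Euclidean bookkeeping -/

/-- Coordinates of `M w`: `(M w)_i = M_{i0} w₀ + M_{i1} w₁`. [folklore] -/
theorem toEuclideanLin_apply_two (M : Matrix (Fin 2) (Fin 2) ℝ) (w : EuclideanSpace ℝ (Fin 2)) (i : Fin 2) :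
    (Matrix.toEuclideanLin M w) i = M i 0 * w 0 + M i 1 * w 1 := by
  show (M *ᵥ w.ofLp) i = _
  simp [Matrix.mulVec, dotProduct, Fin.sum_univ_two]

/-- The row functional is dominated by the image norm: `|M_{i0}w₀ + M_{i1}w₁| ≤ ‖M w‖`. [folklore] -/
theorem abs_row_dot_le_norm_apply (M : Matrix (Fin 2) (Fin 2) ℝ) (w : EuclideanSpace ℝ (Fin 2)) (i : Fin 2) :
    |M i 0 * w 0 + M i 1 * w 1| ≤ ‖Matrix.toEuclideanLin M w‖ := by
  set u := Matrix.toEuclideanLin M w with hu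
  have h : ‖u‖ ^ 2 = u 0 ^ 2 + u 1 ^ 2 := by
    rw [EuclideanSpace.norm_sq_eq]; simp [Fin.sum_univ_two]
  rw [← toEuclideanLin_apply_two, ← hu]
  refine abs_le_of_sq_le_sq ?_ (norm_nonneg u)
  fin_cases i
  · show u 0 ^ 2 ≤ ‖u‖ ^ 2
    nlinarith [sq_nonneg (u 1)]
  · show u 1 ^ 2 ≤ ‖u‖ ^ 2
    nlinarith [sq_nonneg (u 0)]

/-- `‖M w‖² ≤ ‖M‖_F² · ‖w‖²` with the squared Frobenius norm `Σ M_{ij}²` (Cauchy–Schwarz row by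
row). [folklore] -/
theorem norm_apply_sq_le_frob (M : Matrix (Fin 2) (Fin 2) ℝ) (w : EuclideanSpace ℝ (Fin 2)) :
    ‖Matrix.toEuclideanLin M w‖ ^ 2 ≤ (M 0 0 ^ 2 + M 0 1 ^ 2 + (M 1 0 ^ 2 + M 1 1 ^ 2)) * ‖w‖ ^ 2 := by
  have h1 : ‖Matrix.toEuclideanLin M w‖ ^ 2 =
      (Matrix.toEuclideanLin M w) 0 ^ 2 + (Matrix.toEuclideanLin M w) 1 ^ 2 := by
    rw [EuclideanSpace.norm_sq_eq]; simp [Fin.sum_univ_two]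
  have h2 : ‖w‖ ^ 2 = w 0 ^ 2 + w 1 ^ 2 := by
    rw [EuclideanSpace.norm_sq_eq]; simp [Fin.sum_univ_two]
  rw [h1, h2, toEuclideanLin_apply_two, toEuclideanLin_apply_two]
  nlinarith [sq_nonneg (M 0 0 * w 1 - M 0 1 * w 0), sq_nonneg (M 1 0 * w 1 - M 1 1 * w 0)]

/-- The operator norm is dominated by the Frobenius norm: `‖M‖ ≤ √(Σ M_{ij}²)`. [folklore] -/
theorem norm_le_sqrt_frob (M : Matrix (Fin 2) (Fin 2) ℝ) :
    ‖M‖ ≤ Real.sqrt (M 0 0 ^ 2 + M 0 1 ^ 2 + (M 1 0 ^ 2 + M 1 1 ^ 2)) := by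
  rw [Matrix.l2_opNorm_def]
  refine ContinuousLinearMap.opNorm_le_bound _ (Real.sqrt_nonneg _) fun w => ?_
  have h := norm_apply_sq_le_frob M w
  have h1 : ‖Matrix.toEuclideanLin M w‖ ^ 2 ≤
      (Real.sqrt (M 0 0 ^ 2 + M 0 1 ^ 2 + (M 1 0 ^ 2 + M 1 1 ^ 2)) * ‖w‖) ^ 2 := by
    rw [mul_pow, Real.sq_sqrt (by positivity)]; exact h
  show ‖Matrix.toEuclideanLin M w‖ ≤ Real.sqrt (M 0 0 ^ 2 + M 0 1 ^ 2 + (M 1 0 ^ 2 + M 1 1 ^ 2)) * ‖w‖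
  exact (sq_le_sq₀ (norm_nonneg _) (by positivity)).mp h1

/-- `‖M‖² ≤ Σ M_{ij}²`. [folklore] -/
theorem norm_sq_le_frob (M : Matrix (Fin 2) (Fin 2) ℝ) :
    ‖M‖ ^ 2 ≤ M 0 0 ^ 2 + M 0 1 ^ 2 + (M 1 0 ^ 2 + M 1 1 ^ 2) := by
  have h := norm_le_sqrt_frob M
  calc ‖M‖ ^ 2 ≤ Real.sqrt (M 0 0 ^ 2 + M 0 1 ^ 2 + (M 1 0 ^ 2 + M 1 1 ^ 2)) ^ 2 :=
        pow_le_pow_left₀ (norm_nonneg _) h 2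
    _ = _ := Real.sq_sqrt (by positivity)

/-- `‖M v‖ ≤ ‖M‖ ‖v‖`. [folklore] -/
theorem norm_toEuclideanLin_apply_le (M : Matrix (Fin 2) (Fin 2) ℝ) (v : EuclideanSpace ℝ (Fin 2)) :
    ‖Matrix.toEuclideanLin M v‖ ≤ ‖M‖ * ‖v‖ := by
  rw [Matrix.l2_opNorm_def]
  exact (Matrix.toEuclideanCLM (n := Fin 2) (𝕜 := ℝ) M).le_opNorm v

/-- A unimodular `2 × 2` matrix has operator norm at least `1`
(Hadamard: `1 = det² ≤ ‖M e₀‖² ‖M e₁‖² ≤ ‖M‖⁴`). [folklore] -/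
theorem one_le_norm_of_det_eq_one (M : Matrix (Fin 2) (Fin 2) ℝ) (hM : M.det = 1) : 1 ≤ ‖M‖ := by
  rw [Matrix.det_fin_two] at hM
  set e₀ : EuclideanSpace ℝ (Fin 2) := EuclideanSpace.single (0 : Fin 2) (1 : ℝ)
  set e₁ : EuclideanSpace ℝ (Fin 2) := EuclideanSpace.single (1 : Fin 2) (1 : ℝ)
  have he₀ : ‖e₀‖ = 1 := by simp [e₀]
  have he₁ : ‖e₁‖ = 1 := by simp [e₁]
  have hns : ∀ u : EuclideanSpace ℝ (Fin 2), ‖u‖ ^ 2 = u 0 ^ 2 + u 1 ^ 2 := fun u => by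
    rw [EuclideanSpace.norm_sq_eq]; simp [Fin.sum_univ_two]
  have h0 : ‖Matrix.toEuclideanLin M e₀‖ ^ 2 = M 0 0 ^ 2 + M 1 0 ^ 2 := by
    rw [hns, toEuclideanLin_apply_two, toEuclideanLin_apply_two]
    simp [e₀]
  have h1 : ‖Matrix.toEuclideanLin M e₁‖ ^ 2 = M 0 1 ^ 2 + M 1 1 ^ 2 := by
    rw [hns, toEuclideanLin_apply_two, toEuclideanLin_apply_two]
    simp [e₁]
  have hb0 : ‖Matrix.toEuclideanLin M e₀‖ ≤ ‖M‖ := by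
    simpa [he₀] using norm_toEuclideanLin_apply_le M e₀
  have hb1 : ‖Matrix.toEuclideanLin M e₁‖ ≤ ‖M‖ := by
    simpa [he₁] using norm_toEuclideanLin_apply_le M e₁
  have hn : 0 ≤ ‖M‖ := norm_nonneg _
  -- Lagrange identity: (ad - bc)² + (ab + cd)² = (a² + c²)(b² + d²)
  have hlag : (1 : ℝ) ≤ (M 0 0 ^ 2 + M 1 0 ^ 2) * (M 0 1 ^ 2 + M 1 1 ^ 2) := by
    have : (M 0 0 * M 1 1 - M 0 1 * M 1 0) ^ 2 + (M 0 0 * M 0 1 + M 1 0 * M 1 1) ^ 2 =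
        (M 0 0 ^ 2 + M 1 0 ^ 2) * (M 0 1 ^ 2 + M 1 1 ^ 2) := by ring
    nlinarith [sq_nonneg (M 0 0 * M 0 1 + M 1 0 * M 1 1)]
  have h4 : (1 : ℝ) ≤ ‖M‖ ^ 2 * ‖M‖ ^ 2 := by
    rw [← h0, ← h1] at hlag
    have ha : ‖Matrix.toEuclideanLin M e₀‖ ^ 2 ≤ ‖M‖ ^ 2 := pow_le_pow_left₀ (norm_nonneg _) hb0 2
    have hb : ‖Matrix.toEuclideanLin M e₁‖ ^ 2 ≤ ‖M‖ ^ 2 := pow_le_pow_left₀ (norm_nonneg _) hb1 2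
    calc (1 : ℝ) ≤ _ := hlag
      _ ≤ ‖M‖ ^ 2 * ‖M‖ ^ 2 := mul_le_mul ha hb (sq_nonneg _) (sq_nonneg _)
  by_contra hlt
  rw [not_le] at hlt
  have : ‖M‖ ^ 2 < 1 := by nlinarith
  nlinarith [sq_nonneg ‖M‖]

/-! ### The Lyapunov exponent is below every finite-volume average -/

/-- `log ‖M_n‖ ≥ 0`. [folklore] -/
theorem log_norm_andersonTransferProd_nonneg (E : ℝ) (α : ℕ → ℝ) (n : ℕ) :
    0 ≤ Real.log ‖andersonTransferProd E α n‖ :=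
  Real.log_nonneg (one_le_norm_of_det_eq_one _ (det_andersonTransferProd E α n))

/-- The finite-volume averages are non-negative. [cite: BucajEtAl2019, §2 (`L ≥ 0`)] -/
theorem andersonLogNormAvg_nonneg (μ : Measure ℝ) (E : ℝ) (n : ℕ) : 0 ≤ andersonLogNormAvg μ E n := by
  unfold andersonLogNormAvg
  exact mul_nonneg (by positivity) (integral_nonneg fun α => log_norm_andersonTransferProd_nonneg E _ n)

/-- **`L ≤ n⁻¹ 𝔼 log ‖M_n‖` for every `n ≥ 1`** — the Lyapunov exponent is defined as the infimum
of the (non-negative) finite-volume averages. [cite: BucajEtAl2019, §2 (definition of `L` as an infimum)] -/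
theorem andersonLyapunov_le_logNormAvg (μ : Measure ℝ) (E : ℝ) {n : ℕ} (hn : 1 ≤ n) :
    andersonLyapunov μ E ≤ andersonLogNormAvg μ E n := by
  obtain ⟨k, rfl⟩ : ∃ k, n = k + 1 := ⟨n - 1, by omega⟩
  unfold andersonLyapunov
  exact ciInf_le ⟨0, by rintro _ ⟨j, rfl⟩; exact andersonLogNormAvg_nonneg μ E _⟩ k

/-- `n L ≤ 𝔼 log ‖M_n‖` (`n ≥ 1`). [cite: BucajEtAl2019, §2 (definition of `L`)] -/
theorem mul_andersonLyapunov_le_integral (μ : Measure ℝ) (E : ℝ) {n : ℕ} (hn : 1 ≤ n) :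
    (n : ℝ) * andersonLyapunov μ E ≤
      ∫ α, Real.log ‖andersonTransferProd E (padSeq α) n‖ ∂(Measure.pi fun _ : Fin n => μ) := by
  have h := andersonLyapunov_le_logNormAvg μ E hn
  unfold andersonLogNormAvg at h
  have hn' : (0 : ℝ) < n := by exact_mod_cast hn
  calc (n : ℝ) * andersonLyapunov μ E ≤ n * (1 / (n : ℝ) * ∫ α, Real.log ‖andersonTransferProd E (padSeq α) n‖
        ∂(Measure.pi fun _ : Fin n => μ)) := mul_le_mul_of_nonneg_left h hn'.le
    _ = _ := by field_simp

/-! ### Thin affine slabs under a law with bounded density -/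

/-- If `μ[p, q] ≤ K (q - p)` for all `p, q`, then `μ{|c x + d| < t} ≤ K · 2t/|c|` (`c ≠ 0`). [folklore] -/
theorem measure_abs_affine_lt_le {μ : Measure ℝ} {K : ℝ}
    (hK : ∀ p q : ℝ, μ (Set.Icc p q) ≤ ENNReal.ofReal (K * (q - p))) {c : ℝ} (hc : c ≠ 0) (d t : ℝ) :
    μ {x | |c * x + d| < t} ≤ ENNReal.ofReal (K * (2 * t / |c|)) := by
  have hc' : 0 < |c| := abs_pos.mpr hc
  have hsub : {x : ℝ | |c * x + d| < t} ⊆ Set.Icc (-(d / c) - t / |c|) (-(d / c) + t / |c|) := by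
    intro x hx
    simp only [Set.mem_setOf_eq] at hx
    have hcx : c * (x + d / c) = c * x + d := by field_simp
    have hx' : |c| * |x + d / c| < t := by
      rw [← abs_mul, hcx]; exact hx
    have h2 : |x + d / c| < t / |c| := by
      rw [lt_div_iff₀ hc', mul_comm]; exact hx'
    rw [abs_lt] at h2
    constructor <;> linarith [h2.1, h2.2]
  calc μ {x | |c * x + d| < t} ≤ μ (Set.Icc (-(d / c) - t / |c|) (-(d / c) + t / |c|)) := measure_mono hsub
    _ ≤ ENNReal.ofReal (K * ((-(d / c) + t / |c|) - (-(d / c) - t / |c|))) := hK _ _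
    _ = ENNReal.ofReal (K * (2 * t / |c|)) := by congr 1; ring


/-! ### Two-step direction smoothing -/

/-- The two-step image `M_2(x₀,x₁) v = M^E(x₁) M^E(x₀) v` in coordinates:
`(M_2 v)₀ = (E - x₁) u₀ - v₀`, `(M_2 v)₁ = u₀` with `u₀ = (E - x₀) v₀ - v₁`. [cite: BucajEtAl2019, Def. 2.2] -/
theorem transferProd_two_apply (E : ℝ) (x : Fin 2 → ℝ) (v : EuclideanSpace ℝ (Fin 2)) :
    (Matrix.toEuclideanLin (andersonTransferProd E (padSeq x) 2) v) 0 =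
        (E - x 1) * ((E - x 0) * v 0 - v 1) - v 0 ∧
      (Matrix.toEuclideanLin (andersonTransferProd E (padSeq x) 2) v) 1 = (E - x 0) * v 0 - v 1 := by
  have h2 : andersonTransferProd E (padSeq x) 2 =
      andersonTransfer E (x 1) * andersonTransfer E (x 0) := by
    rw [andersonTransferProd_succ, andersonTransferProd_succ,
      andersonTransferProd_zero, Matrix.mul_one, padSeq_of_lt x (by norm_num : 1 < 2),
      padSeq_of_lt x (by norm_num : 0 < 2)]
    rfl
  rw [h2, toEuclideanLin_mul_apply]
  obtain ⟨ha0, ha1⟩ := andersonTransfer_toEuclideanLin_apply E (x 0) v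
  obtain ⟨hb0, hb1⟩ := andersonTransfer_toEuclideanLin_apply E (x 1)
    (Matrix.toEuclideanLin (andersonTransfer E (x 0)) v)
  rw [hb0, hb1, ha0, ha1]
  exact ⟨rfl, rfl⟩

/-- The pairing of `M_2(x) v` with `s` is `u₀ (s₀ (E - x₁) + s₁) - s₀ v₀`, `u₀ = (E - x₀)v₀ - v₁`:
affine in `x₁` with slope `-s₀ u₀`. [folklore] -/
theorem dot_transferProd_two (E : ℝ) (x : Fin 2 → ℝ) (s v : EuclideanSpace ℝ (Fin 2)) :
    s 0 * (Matrix.toEuclideanLin (andersonTransferProd E (padSeq x) 2) v) 0 +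
        s 1 * (Matrix.toEuclideanLin (andersonTransferProd E (padSeq x) 2) v) 1 =
      ((E - x 0) * v 0 - v 1) * (s 0 * (E - x 1) + s 1) - s 0 * v 0 := by
  obtain ⟨h0, h1⟩ := transferProd_two_apply E x v
  rw [h0, h1]
  ring

/-- Coordinates of a unit vector: `v₀² + v₁² = 1`, `|v₀|, |v₁| ≤ 1`. [folklore] -/
theorem unit_coords {v : EuclideanSpace ℝ (Fin 2)} (hv : ‖v‖ = 1) :
    v 0 ^ 2 + v 1 ^ 2 = 1 ∧ |v 0| ≤ 1 ∧ |v 1| ≤ 1 := by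
  have h : ‖v‖ ^ 2 = v 0 ^ 2 + v 1 ^ 2 := by
    rw [EuclideanSpace.norm_sq_eq]; simp [Fin.sum_univ_two]
  rw [hv, one_pow] at h
  refine ⟨h.symm, ?_, ?_⟩
  · exact abs_le_of_sq_le_sq (by nlinarith [sq_nonneg (v 1)]) zero_le_one
  · exact abs_le_of_sq_le_sq (by nlinarith [sq_nonneg (v 0)]) zero_le_one

/-- **First-step slab.** For a unit vector `v`, `0 ≤ η ≤ 1/2`, a site law with `μ[p,q] ≤ K(q-p)`
supported in `[-R, R]`: `μ{x₀ : |(E - x₀)v₀ - v₁| < η} ≤ 8K(1 + |E| + R) η`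
(if `|v₀| ≥ δ₃ = 1/(4(1+|E|+R))` the slab has width `2η/|v₀|`; otherwise `|u₀| ≥ 3/4` on the
support and the slab is null). [folklore] -/
theorem measure_firstStep_lt_le {μ : Measure ℝ} {K R : ℝ} (hK0 : 0 ≤ K)
    (hK : ∀ p q : ℝ, μ (Set.Icc p q) ≤ ENNReal.ofReal (K * (q - p)))
    (hR : ∀ᵐ x ∂μ, |x| ≤ R) (hR0 : 0 ≤ R) (E : ℝ) {v : EuclideanSpace ℝ (Fin 2)} (hv : ‖v‖ = 1)
    {η : ℝ} (hη0 : 0 ≤ η) (hη : η ≤ 1 / 2) :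
    μ {a | |(E - a) * v 0 - v 1| < η} ≤ ENNReal.ofReal (8 * K * (1 + |E| + R) * η) := by
  obtain ⟨hsq, hv0, hv1⟩ := unit_coords hv
  set Λ : ℝ := 1 + |E| + R with hΛ
  have hΛ1 : 1 ≤ Λ := by rw [hΛ]; linarith [abs_nonneg E]
  have hΛpos : 0 < Λ := by linarith
  by_cases hbig : 1 / (4 * Λ) ≤ |v 0|
  · -- slab of width 2η/|v₀|
    have hv0ne : v 0 ≠ 0 := by
      intro h0; rw [h0, abs_zero] at hbig
      exact absurd hbig (not_le.mpr (by positivity))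
    have hset : {a : ℝ | |(E - a) * v 0 - v 1| < η} = {a | |(-v 0) * a + (E * v 0 - v 1)| < η} := by
      ext a; simp only [Set.mem_setOf_eq]
      rw [show (E - a) * v 0 - v 1 = (-v 0) * a + (E * v 0 - v 1) by ring]
    rw [hset]
    refine (measure_abs_affine_lt_le hK (neg_ne_zero.mpr hv0ne) _ _).trans ?_
    rw [abs_neg]
    apply ENNReal.ofReal_le_ofReal
    have h1 : 2 * η / |v 0| ≤ 2 * η * (4 * Λ) := by
      rw [div_le_iff₀ (abs_pos.mpr hv0ne)]
      calc 2 * η = 2 * η * (4 * Λ) * (1 / (4 * Λ)) := by field_simp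
        _ ≤ 2 * η * (4 * Λ) * |v 0| := by gcongr
    calc K * (2 * η / |v 0|) ≤ K * (2 * η * (4 * Λ)) := mul_le_mul_of_nonneg_left h1 hK0
      _ = 8 * K * Λ * η := by ring
  · -- the slab misses the support
    rw [not_le] at hbig
    have hnull : μ {a | |(E - a) * v 0 - v 1| < η} = 0 := by
      refine measure_mono_null (fun a ha => ?_) (ae_iff.mp hR)
      simp only [Set.mem_setOf_eq] at ha ⊢
      intro haR
      -- |v₁| ≥ 1 - |v₀| and |E - a| ≤ |E| + R give |u₀| ≥ 3/4
      have hv1' : 1 - |v 0| ≤ |v 1| := by nlinarith [abs_nonneg (v 0), abs_nonneg (v 1), sq_abs (v 0), sq_abs (v 1)]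
      have hEa : |E - a| ≤ |E| + R := (abs_sub _ _).trans (by linarith)
      have h14 : |v 0| * (4 * Λ) < 1 := by rwa [lt_div_iff₀ (by positivity)] at hbig
      have hprod : |(E - a) * v 0| ≤ (|E| + R) * |v 0| := by
        rw [abs_mul]; exact mul_le_mul_of_nonneg_right hEa (abs_nonneg _)
      have htri : |v 1| - |(E - a) * v 0| ≤ |(E - a) * v 0 - v 1| := by
        have := abs_sub_abs_le_abs_sub (v 1) ((E - a) * v 0)
        rwa [abs_sub_comm] at this
      have : (3 : ℝ) / 4 ≤ |(E - a) * v 0 - v 1| := by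
        have hΛv : Λ * |v 0| < 1 / 4 := by nlinarith
        have : (|E| + R) * |v 0| ≤ Λ * |v 0| - |v 0| := by rw [hΛ]; ring_nf; rfl
        nlinarith [abs_nonneg (v 0)]
      linarith
    rw [hnull]
    exact bot_le

/-- For a unit vector `s` with `|s₀| ≤ θ ≤ 1/(2(1+|E|+R))` and `|b| ≤ R` the coefficient
`s₀(E - b) + s₁` is at least `1/2` in absolute value. [folklore] -/
theorem half_le_abs_coef {E R θ b : ℝ} {s : EuclideanSpace ℝ (Fin 2)} (hs : ‖s‖ = 1)
    (hs0 : |s 0| ≤ θ) (hθE : θ * (2 * (1 + |E| + R)) ≤ 1) (hb : |b| ≤ R) :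
    1 / 2 ≤ |s 0 * (E - b) + s 1| := by
  obtain ⟨hsq, h0, h1⟩ := unit_coords hs
  have hs1 : 1 - |s 0| ≤ |s 1| := by
    nlinarith [abs_nonneg (s 0), abs_nonneg (s 1), sq_abs (s 0), sq_abs (s 1)]
  have hEb : |E - b| ≤ |E| + R := (abs_sub _ _).trans (by linarith)
  have hprod : |s 0 * (E - b)| ≤ θ * (|E| + R) := by
    rw [abs_mul]; exact mul_le_mul hs0 hEb (abs_nonneg _) ((abs_nonneg _).trans hs0)
  have htri : |s 1| - |s 0 * (E - b)| ≤ |s 0 * (E - b) + s 1| := by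
    have := abs_sub_abs_le_abs_sub (s 1) (-(s 0 * (E - b)))
    rwa [abs_neg, sub_neg_eq_add, add_comm] at this
  nlinarith [abs_nonneg E, (abs_nonneg b).trans hb]

/-- **Two-step smoothing (on `ℝ × ℝ`).** For unit vectors `v, s`, a site law with
`μ[p,q] ≤ K(q-p)` supported in `[-R,R]`, and `0 < θ ≤ min(1/8, 1/(2(1+|E|+R)))`:
`(μ ⊗ μ){(x₀,x₁) : |u₀ (s₀(E - x₁) + s₁) - s₀ v₀| < θ³} ≤ (2K + 24K(1+|E|+R)) θ`,
`u₀ = (E - x₀)v₀ - v₁` — i.e. `ℙ(|⟨s, M_2 v⟩| < θ³) ≲ θ`.  Cases: `|s₀| ≥ θ` and `|s₀u₀| ≥ θ²`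
(slab in `x₁` of width `2θ³/θ²`); `|s₀| ≥ θ` and `|s₀u₀| < θ²` (then `|u₀| < θ`, first-step
slab); `|s₀| < θ` (then the coefficient is `≥ 1/2` and `|u₀| < 2(θ³ + θ)`, first-step slab). [folklore] -/
theorem prod_measure_twoStep_lt_le {μ : Measure ℝ} [IsProbabilityMeasure μ] {K R : ℝ} (hK0 : 0 ≤ K)
    (hK : ∀ p q : ℝ, μ (Set.Icc p q) ≤ ENNReal.ofReal (K * (q - p)))
    (hR : ∀ᵐ x ∂μ, |x| ≤ R) (hR0 : 0 ≤ R) (E : ℝ) {v s : EuclideanSpace ℝ (Fin 2)} (hv : ‖v‖ = 1)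
    (hs : ‖s‖ = 1) {θ : ℝ} (hθ0 : 0 < θ) (hθ8 : θ ≤ 1 / 8) (hθE : θ * (2 * (1 + |E| + R)) ≤ 1) :
    (μ.prod μ) {p : ℝ × ℝ | |((E - p.1) * v 0 - v 1) * (s 0 * (E - p.2) + s 1) - s 0 * v 0| < θ ^ 3} ≤
      ENNReal.ofReal ((2 * K + 24 * K * (1 + |E| + R)) * θ) := by
  obtain ⟨hvsq, hv0, hv1⟩ := unit_coords hv
  set Λ : ℝ := 1 + |E| + R with hΛ
  have hΛ1 : 1 ≤ Λ := by rw [hΛ]; linarith [abs_nonneg E]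
  set u : ℝ → ℝ := fun a => (E - a) * v 0 - v 1 with hu
  set T : Set (ℝ × ℝ) := {p | |u p.1 * (s 0 * (E - p.2) + s 1) - s 0 * v 0| < θ ^ 3} with hT
  have hTm : MeasurableSet T := by
    refine measurableSet_lt ?_ measurable_const
    simp only [hu]
    fun_prop
  have hθ3 : θ ^ 3 ≤ θ / 64 := by nlinarith [pow_le_pow_left₀ hθ0.le hθ8 2]
  have hfirst : ∀ {η : ℝ}, 0 ≤ η → η ≤ 1 / 2 → μ {a | |u a| < η} ≤ ENNReal.ofReal (8 * K * Λ * η) :=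
    fun hη0 hη => measure_firstStep_lt_le hK0 hK hR hR0 E hv hη0 hη
  show (μ.prod μ) T ≤ _
  by_cases hcase : θ ≤ |s 0|
  · -- Case A: split the x₀-integral according to |s₀ u₀| ≥ θ²
    rw [Measure.prod_apply hTm]
    set S : Set ℝ := {a | |u a| < θ} with hS
    have hSm : MeasurableSet S := measurableSet_lt (by simp only [hu]; fun_prop) measurable_const
    have hpt : ∀ a, μ (Prod.mk a ⁻¹' T) ≤ ENNReal.ofReal (2 * K * θ) + S.indicator 1 a := by
      intro a
      by_cases hbig : θ ^ 2 ≤ |s 0 * u a|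
      · have hne : -(s 0 * u a) ≠ 0 := by
          intro h0
          rw [neg_eq_zero] at h0
          rw [h0, abs_zero] at hbig
          nlinarith
        have hsec : Prod.mk a ⁻¹' T = {b | |(-(s 0 * u a)) * b + (u a * (s 0 * E + s 1) - s 0 * v 0)| < θ ^ 3} := by
          ext b
          simp only [hT, Set.mem_preimage, Set.mem_setOf_eq]
          rw [show u a * (s 0 * (E - b) + s 1) - s 0 * v 0 =
            (-(s 0 * u a)) * b + (u a * (s 0 * E + s 1) - s 0 * v 0) by ring]
        rw [hsec]
        refine (measure_abs_affine_lt_le hK hne _ _).trans ?_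
        refine le_trans ?_ le_self_add
        apply ENNReal.ofReal_le_ofReal
        rw [abs_neg]
        have hpos : 0 < |s 0 * u a| := lt_of_lt_of_le (by positivity) hbig
        have : 2 * θ ^ 3 / |s 0 * u a| ≤ 2 * θ := by
          rw [div_le_iff₀ hpos]
          nlinarith
        nlinarith
      · rw [not_le] at hbig
        have haS : a ∈ S := by
          simp only [hS, Set.mem_setOf_eq]
          have hs0pos : 0 < |s 0| := hθ0.trans_le hcase
          have : |s 0| * |u a| < θ * |s 0| := by
            rw [← abs_mul]; nlinarith
          nlinarith
        rw [Set.indicator_of_mem haS, Pi.one_apply]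
        exact le_add_left prob_le_one
    calc ∫⁻ a, μ (Prod.mk a ⁻¹' T) ∂μ ≤ ∫⁻ a, (ENNReal.ofReal (2 * K * θ) + S.indicator 1 a) ∂μ :=
          lintegral_mono hpt
      _ = ENNReal.ofReal (2 * K * θ) + μ S := by
          rw [lintegral_add_left measurable_const, lintegral_const, lintegral_indicator_one hSm]
          simp
      _ ≤ ENNReal.ofReal (2 * K * θ) + ENNReal.ofReal (8 * K * Λ * θ) :=
          add_le_add le_rfl (hfirst hθ0.le (by linarith))
      _ = ENNReal.ofReal ((2 * K + 8 * K * Λ) * θ) := by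
          rw [← ENNReal.ofReal_add (by positivity) (by positivity)]; ring_nf
      _ ≤ ENNReal.ofReal ((2 * K + 24 * K * Λ) * θ) := by
          apply ENNReal.ofReal_le_ofReal
          have : 0 ≤ K * Λ * θ := by positivity
          nlinarith
  · -- Case B: the coefficient is ≥ 1/2, so |u₀| < 2(θ³ + θ) on the support
    rw [not_le] at hcase
    set S : Set ℝ := {a | |u a| < 2 * (θ ^ 3 + θ)} with hS
    have hsub : T ⊆ S ×ˢ Set.univ ∪ Set.univ ×ˢ {b | R < |b|} := by
      rintro ⟨a, b⟩ hab
      by_cases hb : |b| ≤ R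
      · left
        refine ⟨?_, Set.mem_univ _⟩
        simp only [hS, Set.mem_setOf_eq]
        simp only [hT, Set.mem_setOf_eq] at hab
        have hcoef := half_le_abs_coef (E := E) hs hcase.le hθE hb
        have h1 : |u a| * |s 0 * (E - b) + s 1| - |s 0 * v 0| ≤
            |u a * (s 0 * (E - b) + s 1) - s 0 * v 0| := by
          rw [← abs_mul]; exact abs_sub_abs_le_abs_sub _ _
        have h2 : |s 0 * v 0| ≤ θ := by
          rw [abs_mul]
          calc |s 0| * |v 0| ≤ θ * 1 := mul_le_mul hcase.le hv0 (abs_nonneg _) hθ0.le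
            _ = θ := mul_one θ
        nlinarith [abs_nonneg (u a)]
      · right
        exact ⟨Set.mem_univ _, by simpa using hb⟩
    have hnull : μ {b | R < |b|} = 0 := by
      have := ae_iff.mp hR
      simpa [not_le] using this
    calc (μ.prod μ) T ≤ (μ.prod μ) (S ×ˢ Set.univ ∪ Set.univ ×ˢ {b | R < |b|}) := measure_mono hsub
      _ ≤ (μ.prod μ) (S ×ˢ Set.univ) + (μ.prod μ) (Set.univ ×ˢ {b | R < |b|}) := measure_union_le _ _
      _ = μ S := by rw [Measure.prod_prod, Measure.prod_prod, hnull]; simp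
      _ ≤ ENNReal.ofReal (8 * K * Λ * (2 * (θ ^ 3 + θ))) := hfirst (by positivity) (by nlinarith)
      _ ≤ ENNReal.ofReal ((2 * K + 24 * K * Λ) * θ) := by
          apply ENNReal.ofReal_le_ofReal
          have hKΛ : 0 ≤ K * Λ := by positivity
          nlinarith

/-- **Two-step smoothing for the transfer matrices.** For unit vectors `v, s` and
`0 < θ ≤ min(1/8, 1/(2(1+|E|+R)))`,
`μ^{⊗2}{x : |⟨s, M_2(x) v⟩| < θ³} ≤ (2K + 24K(1+|E|+R)) θ`. [folklore] -/
theorem pi_two_measure_dot_lt_le {μ : Measure ℝ} [IsProbabilityMeasure μ] {K R : ℝ} (hK0 : 0 ≤ K)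
    (hK : ∀ p q : ℝ, μ (Set.Icc p q) ≤ ENNReal.ofReal (K * (q - p)))
    (hR : ∀ᵐ x ∂μ, |x| ≤ R) (hR0 : 0 ≤ R) (E : ℝ) {v s : EuclideanSpace ℝ (Fin 2)} (hv : ‖v‖ = 1)
    (hs : ‖s‖ = 1) {θ : ℝ} (hθ0 : 0 < θ) (hθ8 : θ ≤ 1 / 8) (hθE : θ * (2 * (1 + |E| + R)) ≤ 1) :
    (Measure.pi fun _ : Fin 2 => μ)
        {x | |s 0 * (Matrix.toEuclideanLin (andersonTransferProd E (padSeq x) 2) v) 0 +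
            s 1 * (Matrix.toEuclideanLin (andersonTransferProd E (padSeq x) 2) v) 1| < θ ^ 3} ≤
      ENNReal.ofReal ((2 * K + 24 * K * (1 + |E| + R)) * θ) := by
  set T : Set (ℝ × ℝ) :=
    {p | |((E - p.1) * v 0 - v 1) * (s 0 * (E - p.2) + s 1) - s 0 * v 0| < θ ^ 3} with hT
  have hTm : MeasurableSet T := by
    refine measurableSet_lt ?_ measurable_const
    fun_prop
  have hset : {x : Fin 2 → ℝ | |s 0 * (Matrix.toEuclideanLin (andersonTransferProd E (padSeq x) 2) v) 0 +
        s 1 * (Matrix.toEuclideanLin (andersonTransferProd E (padSeq x) 2) v) 1| < θ ^ 3}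
      = MeasurableEquiv.finTwoArrow ⁻¹' T := by
    ext x
    simp only [Set.mem_setOf_eq, Set.mem_preimage, hT, dot_transferProd_two]
    rfl
  rw [hset, (measurePreserving_finTwoArrow μ).measure_preimage hTm.nullMeasurableSet]
  exact prod_measure_twoStep_lt_le hK0 hK hR hR0 E hv hs hθ0 hθ8 hθE

/-! ### The larger row of a unimodular matrix -/

/-- **Bad rows are `t`-orthogonal to the larger row.** For a unimodular `B` there is a unit vector
`s` (the normalised row of larger norm) such that whenever both row functionals are small on `w`,
`(r_i · w)² < t² · (Σ B_{ij}²)/2`, then `|s · w| < t`. [folklore] -/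
theorem exists_unit_largerRow (B : Matrix (Fin 2) (Fin 2) ℝ) (hB : B.det = 1) :
    ∃ s : EuclideanSpace ℝ (Fin 2), ‖s‖ = 1 ∧ ∀ (w : EuclideanSpace ℝ (Fin 2)) (t : ℝ), 0 ≤ t →
      (∀ i, (B i 0 * w 0 + B i 1 * w 1) ^ 2 < t ^ 2 * ((B 0 0 ^ 2 + B 0 1 ^ 2 + (B 1 0 ^ 2 + B 1 1 ^ 2)) / 2)) →
        |s 0 * w 0 + s 1 * w 1| < t := by
  -- the row of larger norm carries at least half of the Frobenius norm, which is ≥ 1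
  have hfr : 1 ≤ B 0 0 ^ 2 + B 0 1 ^ 2 + (B 1 0 ^ 2 + B 1 1 ^ 2) := by
    have h1 : 1 ≤ ‖B‖ := one_le_norm_of_det_eq_one B hB
    exact le_trans (by nlinarith) (norm_sq_le_frob B)
  obtain ⟨i, hi⟩ : ∃ i : Fin 2,
      (B 0 0 ^ 2 + B 0 1 ^ 2 + (B 1 0 ^ 2 + B 1 1 ^ 2)) / 2 ≤ B i 0 ^ 2 + B i 1 ^ 2 := by
    by_cases h : B 1 0 ^ 2 + B 1 1 ^ 2 ≤ B 0 0 ^ 2 + B 0 1 ^ 2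
    · exact ⟨0, by linarith⟩
    · exact ⟨1, by rw [not_le] at h; linarith⟩
  set ρ : ℝ := B i 0 ^ 2 + B i 1 ^ 2 with hρ
  have hρpos : 0 < ρ := by linarith
  have hsρ : 0 < Real.sqrt ρ := Real.sqrt_pos.mpr hρpos
  have hsq : Real.sqrt ρ ^ 2 = ρ := Real.sq_sqrt hρpos.le
  set s : EuclideanSpace ℝ (Fin 2) := WithLp.toLp 2 fun j => B i j / Real.sqrt ρ with hsdef
  have hs_apply : ∀ j, s j = B i j / Real.sqrt ρ := fun j => rfl
  refine ⟨s, ?_, fun w t ht hbad => ?_⟩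
  · have h : ‖s‖ ^ 2 = 1 := by
      have hn : ‖s‖ ^ 2 = s 0 ^ 2 + s 1 ^ 2 := by
        rw [EuclideanSpace.norm_sq_eq]; simp [Fin.sum_univ_two]
      rw [hn, hs_apply, hs_apply, div_pow, div_pow, hsq, ← add_div]
      exact div_self hρpos.ne'
    have h0 : 0 ≤ ‖s‖ := norm_nonneg _
    nlinarith
  · have hdot : s 0 * w 0 + s 1 * w 1 = (B i 0 * w 0 + B i 1 * w 1) / Real.sqrt ρ := by
      rw [hs_apply, hs_apply]
      field_simp
    rw [hdot, abs_div, abs_of_pos hsρ, div_lt_iff₀ hsρ]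
    have h3 : (B i 0 * w 0 + B i 1 * w 1) ^ 2 < (t * Real.sqrt ρ) ^ 2 := by
      rw [mul_pow, hsq]
      exact lt_of_lt_of_le (hbad i) (by nlinarith [sq_nonneg t])
    have := sq_lt_sq.mp h3
    rwa [abs_of_nonneg (by positivity : 0 ≤ t * Real.sqrt ρ)] at this

/-- **A good row gives growth**: if `(r_i · w)² ≥ (θ‖w‖)² (Σ B_{ij}²)/2` for some row then
`log ‖B w‖ ≥ log θ + log ‖B‖ + log ‖w‖ - log √2`. [folklore] -/
theorem log_norm_apply_ge_of_row (B : Matrix (Fin 2) (Fin 2) ℝ) (hB : B.det = 1)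
    {w : EuclideanSpace ℝ (Fin 2)} (hw : w ≠ 0) {θ : ℝ} (hθ : 0 < θ) (i : Fin 2)
    (hgood : (θ * ‖w‖) ^ 2 * ((B 0 0 ^ 2 + B 0 1 ^ 2 + (B 1 0 ^ 2 + B 1 1 ^ 2)) / 2) ≤
      (B i 0 * w 0 + B i 1 * w 1) ^ 2) :
    Real.log θ + Real.log ‖B‖ + Real.log ‖w‖ - Real.log (Real.sqrt 2) ≤
      Real.log ‖Matrix.toEuclideanLin B w‖ := by
  have hB1 : 1 ≤ ‖B‖ := one_le_norm_of_det_eq_one B hB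
  have hwpos : 0 < ‖w‖ := norm_pos_iff.mpr hw
  have hs2 : 0 < Real.sqrt 2 := Real.sqrt_pos.mpr two_pos
  set m : ℝ := θ * ‖B‖ * ‖w‖ / Real.sqrt 2 with hm
  have hmpos : 0 < m := by positivity
  have hm2 : m ^ 2 ≤ ‖Matrix.toEuclideanLin B w‖ ^ 2 := by
    have hrow := abs_row_dot_le_norm_apply B w i
    have hrow2 : (B i 0 * w 0 + B i 1 * w 1) ^ 2 ≤ ‖Matrix.toEuclideanLin B w‖ ^ 2 := by
      rw [← sq_abs]; exact pow_le_pow_left₀ (abs_nonneg _) hrow 2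
    have hfr := norm_sq_le_frob B
    calc m ^ 2 = (θ * ‖w‖) ^ 2 * (‖B‖ ^ 2 / 2) := by
          rw [hm, div_pow, Real.sq_sqrt zero_le_two]; ring
      _ ≤ (θ * ‖w‖) ^ 2 * ((B 0 0 ^ 2 + B 0 1 ^ 2 + (B 1 0 ^ 2 + B 1 1 ^ 2)) / 2) := by gcongr
      _ ≤ _ := hgood.trans hrow2
  have hle : m ≤ ‖Matrix.toEuclideanLin B w‖ := (sq_le_sq₀ hmpos.le (norm_nonneg _)).mp hm2
  have hlog := Real.log_le_log hmpos hle
  have hlogm : Real.log m = Real.log θ + Real.log ‖B‖ + Real.log ‖w‖ - Real.log (Real.sqrt 2) := by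
    rw [hm, Real.log_div (by positivity) hs2.ne', Real.log_mul (by positivity) hwpos.ne',
      Real.log_mul hθ.ne' (by positivity)]
  linarith

/-! ### Splitting an i.i.d. sample into the first `p` and the last `q` sites -/

/-- The append map `(x, y) ↦ x ⧺ y` is measurable. [folklore] -/
theorem measurable_finAppend (p q : ℕ) :
    Measurable fun w : (Fin p → ℝ) × (Fin q → ℝ) => Fin.append w.1 w.2 := by
  refine measurable_pi_iff.mpr fun i => ?_
  induction i using Fin.addCases with
  | left j =>
    simp only [Fin.append_left]
    exact (measurable_pi_apply j).comp measurable_fst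
  | right j =>
    simp only [Fin.append_right]
    exact (measurable_pi_apply j).comp measurable_snd

/-- The append map transports `μ^{⊗p} ⊗ μ^{⊗q}` to `μ^{⊗(p+q)}` (it is the measurable equivalence
`(Fin p ⊕ Fin q → ℝ) ≃ (Fin p → ℝ) × (Fin q → ℝ)` composed with re-indexing along
`finSumFinEquiv`). [folklore] -/
theorem measurePreserving_finAppend (μ : Measure ℝ) [SigmaFinite μ] (p q : ℕ) :
    MeasurePreserving (fun w : (Fin p → ℝ) × (Fin q → ℝ) => Fin.append w.1 w.2)
      ((Measure.pi fun _ : Fin p => μ).prod (Measure.pi fun _ : Fin q => μ))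
      (Measure.pi fun _ : Fin (p + q) => μ) := by
  let e : ((Fin p → ℝ) × (Fin q → ℝ)) ≃ᵐ (Fin (p + q) → ℝ) :=
    (MeasurableEquiv.sumPiEquivProdPi (fun _ : Fin p ⊕ Fin q => ℝ)).symm.trans
      (MeasurableEquiv.piCongrLeft (fun _ : Fin (p + q) => ℝ) finSumFinEquiv)
  have he_apply : ∀ w : (Fin p → ℝ) × (Fin q → ℝ), e w = Fin.append w.1 w.2 := by
    rintro ⟨x, y⟩
    funext i
    rcases finSumFinEquiv.surjective i with ⟨s, rfl⟩
    simp only [e, MeasurableEquiv.trans_apply, MeasurableEquiv.coe_piCongrLeft, Equiv.piCongrLeft_apply_apply]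
    rcases s with i₀ | j₀
    · rw [finSumFinEquiv_apply_left, Fin.append_left]
      rfl
    · rw [finSumFinEquiv_apply_right, Fin.append_right]
      rfl
  have he : MeasurePreserving e
      ((Measure.pi fun _ : Fin p => μ).prod (Measure.pi fun _ : Fin q => μ))
      (Measure.pi fun _ : Fin (p + q) => μ) :=
    (measurePreserving_sumPiEquivProdPi_symm (fun _ : Fin p ⊕ Fin q => μ)).trans
      (measurePreserving_piCongrLeft (fun _ : Fin (p + q) => μ) finSumFinEquiv)
  have hfun : (fun w : (Fin p → ℝ) × (Fin q → ℝ) => Fin.append w.1 w.2) = e := funext fun w => (he_apply w).symm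
  rw [hfun]
  exact he

/-- Bochner version of the block splitting: `∫ F dμ^{⊗(p+q)} = ∫ F(x ⧺ y) d(μ^{⊗p} ⊗ μ^{⊗q})(x,y)`
for measurable `F`. [folklore] -/
theorem integral_pi_fin_add_eq_integral_prod (μ : Measure ℝ) [SigmaFinite μ] (p q : ℕ)
    {F : (Fin (p + q) → ℝ) → ℝ} (hF : Measurable F) :
    ∫ z, F z ∂(Measure.pi fun _ : Fin (p + q) => μ) =
      ∫ w, F (Fin.append w.1 w.2) ∂((Measure.pi fun _ : Fin p => μ).prod (Measure.pi fun _ : Fin q => μ)) := by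
  rw [← (measurePreserving_finAppend μ p q).map_eq, integral_map (measurable_finAppend p q).aemeasurable
    hF.aestronglyMeasurable]

/-- Coordinates of an i.i.d. sample are a.s. in the support interval. [folklore] -/
theorem ae_pi_abs_le {μ : Measure ℝ} [IsProbabilityMeasure μ] {R : ℝ} (hR : ∀ᵐ x ∂μ, |x| ≤ R) (n : ℕ) :
    ∀ᵐ x ∂(Measure.pi fun _ : Fin n => μ), ∀ i, |x i| ≤ R := by
  rw [ae_all_iff]
  intro i
  have hmap : ∀ᵐ a ∂(Measure.map (Function.eval i) (Measure.pi fun _ : Fin n => μ)), |a| ≤ R := by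
    rw [(measurePreserving_eval (fun _ : Fin n => μ) i).map_eq]; exact hR
  exact (ae_map_iff (measurable_pi_apply i).aemeasurable
    (measurableSet_le continuous_abs.measurable measurable_const)).mp hmap

/-- On the support box the potentials are bounded: `|E - α_k| ≤ |E| + R`. [folklore] -/
theorem abs_sub_padSeq_le {n : ℕ} {x : Fin n → ℝ} {R : ℝ} (hx : ∀ i, |x i| ≤ R) (E : ℝ) :
    ∀ k, k < n → |E - padSeq x k| ≤ |E| + R := by
  intro k hk
  rw [padSeq_of_lt x hk]
  exact (abs_sub _ _).trans (by linarith [hx ⟨k, hk⟩])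

/-! ### The main estimate -/

/-- **Section bound for the bad event.** For a unimodular `B` (the later block, frozen) and
`θ = η³/(D+1)²`, `D = |E| + R`: the first-block samples `x` in the support box for which BOTH
row functionals of `B` are small on `w = M_2(x) v`,
`(r_i · w)² < (θ‖w‖)² (Σ B_{ij}²)/2`, have probability `≤ (2K + 24K(1+|E|+R)) η`. [folklore] -/
theorem pi_two_measure_badRows_le {μ : Measure ℝ} [IsProbabilityMeasure μ] {K R : ℝ} (hK0 : 0 ≤ K)
    (hK : ∀ p q : ℝ, μ (Set.Icc p q) ≤ ENNReal.ofReal (K * (q - p)))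
    (hR : ∀ᵐ x ∂μ, |x| ≤ R) (hR0 : 0 ≤ R) (E : ℝ) {v : EuclideanSpace ℝ (Fin 2)} (hv : ‖v‖ = 1)
    (B : Matrix (Fin 2) (Fin 2) ℝ) (hB : B.det = 1)
    {η : ℝ} (hη0 : 0 < η) (hη8 : η ≤ 1 / 8) (hηE : η * (2 * (1 + |E| + R)) ≤ 1) :
    (Measure.pi fun _ : Fin 2 => μ)
        {x | (∀ i, |x i| ≤ R) ∧ ∀ i,
          (B i 0 * (Matrix.toEuclideanLin (andersonTransferProd E (padSeq x) 2) v) 0 +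
              B i 1 * (Matrix.toEuclideanLin (andersonTransferProd E (padSeq x) 2) v) 1) ^ 2 <
            (η ^ 3 / (|E| + R + 1) ^ 2 * ‖Matrix.toEuclideanLin (andersonTransferProd E (padSeq x) 2) v‖) ^ 2 *
              ((B 0 0 ^ 2 + B 0 1 ^ 2 + (B 1 0 ^ 2 + B 1 1 ^ 2)) / 2)} ≤
      ENNReal.ofReal ((2 * K + 24 * K * (1 + |E| + R)) * η) := by
  set D : ℝ := |E| + R with hD
  have hD0 : 0 ≤ D := by positivity
  have hD1 : (1 : ℝ) ≤ (D + 1) ^ 2 := by nlinarith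
  obtain ⟨s, hs, hsrow⟩ := exists_unit_largerRow B hB
  refine le_trans (measure_mono ?_) (pi_two_measure_dot_lt_le hK0 hK hR hR0 E hv hs hη0 hη8 hηE)
  intro x hx
  obtain ⟨hbox, hrows⟩ := hx
  simp only [Set.mem_setOf_eq]
  set w := Matrix.toEuclideanLin (andersonTransferProd E (padSeq x) 2) v with hw
  have hwle : ‖w‖ ≤ (D + 1) ^ 2 := by
    have := (norm_andersonTransferProd_apply_bounds E hD0 (padSeq x) v 2
      (abs_sub_padSeq_le hbox E)).1
    rwa [hv, mul_one] at this
  have hθw : 0 ≤ η ^ 3 / (D + 1) ^ 2 * ‖w‖ := by positivity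
  have h := hsrow w _ hθw hrows
  refine lt_of_lt_of_le h ?_
  calc η ^ 3 / (D + 1) ^ 2 * ‖w‖ ≤ η ^ 3 / (D + 1) ^ 2 * (D + 1) ^ 2 := by gcongr
    _ = η ^ 3 := by field_simp

/-- **Uniform growth of every vector from the Lyapunov exponent (quantitative form).** For a
site law with `μ[p,q] ≤ K(q-p)` supported in `[-R,R]`, every `q ≥ 1`, every
`0 < η ≤ min(1/8, 1/(2(1+|E|+R)))` and every unit vector `v`,
`𝔼 log ‖M_{2+q} v‖ ≥ q·L(E) - 4 log(D+1) + 3 log η - log √2 - 2 q log(D+1) · C₁ η`,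
`D = |E| + R`, `C₁ = 2K + 24K(1+|E|+R)` (two-step smoothing of the direction of `M_2 v`, the
later `q` steps contributing `𝔼 log‖M_q‖ ≥ qL` on the good event). [folklore] -/
theorem integral_log_norm_apply_ge {μ : Measure ℝ} [IsProbabilityMeasure μ] {K R : ℝ} (hK0 : 0 ≤ K)
    (hK : ∀ p q : ℝ, μ (Set.Icc p q) ≤ ENNReal.ofReal (K * (q - p)))
    (hR : ∀ᵐ x ∂μ, |x| ≤ R) (hR0 : 0 ≤ R) (E : ℝ) {q : ℕ} (hq : 1 ≤ q)
    {η : ℝ} (hη0 : 0 < η) (hη8 : η ≤ 1 / 8) (hηE : η * (2 * (1 + |E| + R)) ≤ 1)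
    {v : EuclideanSpace ℝ (Fin 2)} (hv : ‖v‖ = 1) :
    (q : ℝ) * andersonLyapunov μ E - 4 * Real.log (|E| + R + 1) + 3 * Real.log η
        - Real.log (Real.sqrt 2)
        - 2 * (q * Real.log (|E| + R + 1)) * ((2 * K + 24 * K * (1 + |E| + R)) * η) ≤
      ∫ z, Real.log ‖Matrix.toEuclideanLin (andersonTransferProd E (padSeq z) (2 + q)) v‖
        ∂(Measure.pi fun _ : Fin (2 + q) => μ) := by
  -- constants
  set D : ℝ := |E| + R with hD
  have hD0 : 0 ≤ D := by positivity
  have hD1 : 1 ≤ D + 1 := by linarith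
  set Λ : ℝ := Real.log (D + 1) with hΛ
  have hΛ0 : 0 ≤ Λ := Real.log_nonneg hD1
  set C₁ : ℝ := 2 * K + 24 * K * (1 + |E| + R) with hC₁
  have hC₁0 : 0 ≤ C₁ := by positivity
  set θ : ℝ := η ^ 3 / (D + 1) ^ 2 with hθ
  have hθpos : 0 < θ := by positivity
  have hθle : θ ≤ 1 := by
    rw [hθ, div_le_one (by positivity)]
    calc η ^ 3 ≤ 1 := pow_le_one₀ hη0.le (by linarith)
      _ ≤ (D + 1) ^ 2 := by nlinarith
  have hlogθ : Real.log θ = 3 * Real.log η - 2 * Λ := by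
    rw [hθ, Real.log_div (by positivity) (by positivity), Real.log_pow, Real.log_pow]
    push_cast; ring
  have hlogθ0 : Real.log θ ≤ 0 := Real.log_nonpos hθpos.le hθle
  have hs2 : 0 ≤ Real.log (Real.sqrt 2) := Real.log_nonneg Real.one_lt_sqrt_two.le
  -- measures
  set Px : Measure (Fin 2 → ℝ) := Measure.pi fun _ : Fin 2 => μ with hPx
  set Py : Measure (Fin q → ℝ) := Measure.pi fun _ : Fin q => μ with hPy
  -- the objects
  set wv : (Fin 2 → ℝ) → EuclideanSpace ℝ (Fin 2) := fun x =>
    Matrix.toEuclideanLin (andersonTransferProd E (padSeq x) 2) v with hwv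
  set B : (Fin q → ℝ) → Matrix (Fin 2) (Fin 2) ℝ := fun y => andersonTransferProd E (padSeq y) q with hB
  set G : (Fin q → ℝ) → ℝ := fun y => Real.log ‖B y‖ with hG
  set g' : (Fin 2 → ℝ) × (Fin q → ℝ) → ℝ := fun w =>
    Real.log ‖Matrix.toEuclideanLin (B w.2) (wv w.1)‖ with hg'
  -- deterministic bounds on the boxes
  have hw_bounds : ∀ x : Fin 2 → ℝ, (∀ i, |x i| ≤ R) →
      ‖wv x‖ ≤ (D + 1) ^ 2 ∧ 1 ≤ (D + 1) ^ 2 * ‖wv x‖ := by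
    intro x hx
    have := norm_andersonTransferProd_apply_bounds E hD0 (padSeq x) v 2 (abs_sub_padSeq_le hx E)
    rwa [hv, mul_one] at this
  have hB_bounds : ∀ y : Fin q → ℝ, (∀ i, |y i| ≤ R) → ∀ u : EuclideanSpace ℝ (Fin 2),
      ‖Matrix.toEuclideanLin (B y) u‖ ≤ (D + 1) ^ q * ‖u‖ ∧
        ‖u‖ ≤ (D + 1) ^ q * ‖Matrix.toEuclideanLin (B y) u‖ :=
    fun y hy u => norm_andersonTransferProd_apply_bounds E hD0 (padSeq y) u q (abs_sub_padSeq_le hy E)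
  have hB_norm : ∀ y : Fin q → ℝ, (∀ i, |y i| ≤ R) → ‖B y‖ ≤ (D + 1) ^ q :=
    fun y hy => norm_andersonTransferProd_le E hD0 (padSeq y) q (abs_sub_padSeq_le hy E)
  have hB_det : ∀ y, (B y).det = 1 := fun y => det_andersonTransferProd E _ q
  have hG_bounds : ∀ y : Fin q → ℝ, (∀ i, |y i| ≤ R) → 0 ≤ G y ∧ G y ≤ q * Λ := by
    intro y hy
    refine ⟨Real.log_nonneg (one_le_norm_of_det_eq_one _ (hB_det y)), ?_⟩
    calc G y ≤ Real.log ((D + 1) ^ q) :=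
          Real.log_le_log (by linarith [one_le_norm_of_det_eq_one _ (hB_det y)]) (hB_norm y hy)
      _ = q * Λ := by rw [Real.log_pow]
  -- |g'| ≤ (q + 2) Λ on the box
  have hg'_bound : ∀ w : (Fin 2 → ℝ) × (Fin q → ℝ), (∀ i, |w.1 i| ≤ R) → (∀ i, |w.2 i| ≤ R) →
      -((q + 2) * Λ) ≤ g' w ∧ g' w ≤ (q + 2) * Λ := by
    rintro ⟨x, y⟩ hx hy
    obtain ⟨hw1, hw2⟩ := hw_bounds x hx
    obtain ⟨hb1, hb2⟩ := hB_bounds y hy (wv x)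
    have hDq : (0 : ℝ) < (D + 1) ^ q := by positivity
    have hD2 : (0 : ℝ) < (D + 1) ^ 2 := by positivity
    have hwpos : 0 < ‖wv x‖ := by
      by_contra h0; rw [not_lt] at h0
      have : ‖wv x‖ = 0 := le_antisymm h0 (norm_nonneg _)
      rw [this, mul_zero] at hw2; exact absurd hw2 (by norm_num)
    set r := ‖Matrix.toEuclideanLin (B y) (wv x)‖ with hr
    have hrpos : 0 < r := by
      by_contra h0; rw [not_lt] at h0
      have : r = 0 := le_antisymm h0 (norm_nonneg _)
      rw [this, mul_zero] at hb2; linarith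
    have hup : r ≤ (D + 1) ^ q * (D + 1) ^ 2 := hb1.trans (by gcongr)
    have hlow : 1 ≤ ((D + 1) ^ q * (D + 1) ^ 2) * r := by
      calc (1 : ℝ) ≤ (D + 1) ^ 2 * ‖wv x‖ := hw2
        _ ≤ (D + 1) ^ 2 * ((D + 1) ^ q * r) := by gcongr
        _ = _ := by ring
    have hlogup : Real.log r ≤ (q + 2) * Λ := by
      calc Real.log r ≤ Real.log ((D + 1) ^ q * (D + 1) ^ 2) := Real.log_le_log hrpos hup
        _ = (q + 2) * Λ := by rw [← pow_add, Real.log_pow]; push_cast; ring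
    have hloglow : -((q + 2) * Λ) ≤ Real.log r := by
      have h1 : ((D + 1) ^ q * (D + 1) ^ 2)⁻¹ ≤ r := by
        rw [inv_le_iff_one_le_mul₀ (by positivity), mul_comm]; exact hlow
      calc -((q + 2) * Λ) = Real.log (((D + 1) ^ q * (D + 1) ^ 2)⁻¹) := by
            rw [Real.log_inv, ← pow_add, Real.log_pow]; push_cast; ring
        _ ≤ Real.log r := Real.log_le_log (by positivity) h1
    exact ⟨hloglow, hlogup⟩
  -- a.e. boxes
  have hbox2 : ∀ᵐ x ∂Px, ∀ i, |x i| ≤ R := ae_pi_abs_le hR 2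
  have hboxq : ∀ᵐ y ∂Py, ∀ i, |y i| ≤ R := ae_pi_abs_le hR q
  have hbox : ∀ᵐ w ∂(Px.prod Py), (∀ i, |w.1 i| ≤ R) ∧ (∀ i, |w.2 i| ≤ R) :=
    ((Measure.quasiMeasurePreserving_fst (μ := Px) (ν := Py)).ae hbox2).and
      ((Measure.quasiMeasurePreserving_snd (μ := Px) (ν := Py)).ae hboxq)
  -- transport of the integral to the two blocks
  have hgm : Measurable fun z : Fin (2 + q) → ℝ =>
      Real.log ‖Matrix.toEuclideanLin (andersonTransferProd E (padSeq z) (2 + q)) v‖ :=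
    (measurable_norm_andersonTransferProd_apply E (2 + q) v).log
  have htrans : ∫ z, Real.log ‖Matrix.toEuclideanLin (andersonTransferProd E (padSeq z) (2 + q)) v‖
      ∂(Measure.pi fun _ : Fin (2 + q) => μ) = ∫ w, g' w ∂(Px.prod Py) := by
    rw [integral_pi_fin_add_eq_integral_prod μ 2 q hgm]
    refine integral_congr_ae (ae_of_all _ fun w => ?_)
    simp only [hg', hB, hwv]
    rw [andersonTransferProd_append, toEuclideanLin_mul_apply]
  rw [htrans]
  -- measurability of g' (through the append map) and integrability
  have hg'eq : g' = (fun z : Fin (2 + q) → ℝ =>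
      Real.log ‖Matrix.toEuclideanLin (andersonTransferProd E (padSeq z) (2 + q)) v‖) ∘
        fun w : (Fin 2 → ℝ) × (Fin q → ℝ) => Fin.append w.1 w.2 := by
    funext w
    simp only [Function.comp_apply, hg', hB, hwv]
    rw [andersonTransferProd_append, toEuclideanLin_mul_apply]
  have hg'm : Measurable g' := by
    rw [hg'eq]
    exact hgm.comp (measurable_finAppend 2 q)
  have hg'i : Integrable g' (Px.prod Py) := by
    refine Integrable.of_bound hg'm.aestronglyMeasurable ((q + 2) * Λ) ?_
    filter_upwards [hbox] with w hw
    rw [Real.norm_eq_abs, abs_le]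
    exact hg'_bound w hw.1 hw.2
  have hGm : Measurable fun w : (Fin 2 → ℝ) × (Fin q → ℝ) => G w.2 :=
    ((continuous_norm.comp (continuous_andersonTransferProd E q)).measurable.log).comp measurable_snd
  have hGi : Integrable (fun w : (Fin 2 → ℝ) × (Fin q → ℝ) => G w.2) (Px.prod Py) := by
    refine Integrable.of_bound hGm.aestronglyMeasurable (q * Λ) ?_
    filter_upwards [hbox] with w hw
    obtain ⟨h0, h1⟩ := hG_bounds w.2 hw.2
    rw [Real.norm_eq_abs, abs_of_nonneg h0]
    exact h1
  -- the bad event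
  set bad : Set ((Fin 2 → ℝ) × (Fin q → ℝ)) := {w | (∀ i, |w.1 i| ≤ R) ∧ (∀ i, |w.2 i| ≤ R) ∧
      ∀ i, (B w.2 i 0 * wv w.1 0 + B w.2 i 1 * wv w.1 1) ^ 2 <
        (θ * ‖wv w.1‖) ^ 2 * ((B w.2 0 0 ^ 2 + B w.2 0 1 ^ 2 + (B w.2 1 0 ^ 2 + B w.2 1 1 ^ 2)) / 2)} with hbad
  have hbad_m : MeasurableSet bad := by
    have hc1 : Continuous fun w : (Fin 2 → ℝ) × (Fin q → ℝ) => wv w.1 :=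
      (continuous_andersonTransferProd_apply E 2 v).comp continuous_fst
    have hc1' : ∀ j, Continuous fun w : (Fin 2 → ℝ) × (Fin q → ℝ) => wv w.1 j := fun j =>
      (continuous_apply j).comp ((PiLp.continuous_ofLp 2 _).comp hc1)
    have hc2 : ∀ i j, Continuous fun w : (Fin 2 → ℝ) × (Fin q → ℝ) => B w.2 i j := fun i j =>
      ((continuous_apply j).comp ((continuous_apply i).comp (continuous_andersonTransferProd E q))).comp
        continuous_snd
    have hfrob : Continuous fun w : (Fin 2 → ℝ) × (Fin q → ℝ) =>
        B w.2 0 0 ^ 2 + B w.2 0 1 ^ 2 + (B w.2 1 0 ^ 2 + B w.2 1 1 ^ 2) :=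
      (((hc2 0 0).pow 2).add ((hc2 0 1).pow 2)).add (((hc2 1 0).pow 2).add ((hc2 1 1).pow 2))
    have hbox1 : MeasurableSet {w : (Fin 2 → ℝ) × (Fin q → ℝ) | ∀ i, |w.1 i| ≤ R} := by
      rw [Set.setOf_forall]
      exact MeasurableSet.iInter fun i => measurableSet_le (by fun_prop) measurable_const
    have hbox2' : MeasurableSet {w : (Fin 2 → ℝ) × (Fin q → ℝ) | ∀ i, |w.2 i| ≤ R} := by
      rw [Set.setOf_forall]
      exact MeasurableSet.iInter fun i => measurableSet_le (by fun_prop) measurable_const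
    have hrows : MeasurableSet {w : (Fin 2 → ℝ) × (Fin q → ℝ) |
        ∀ i, (B w.2 i 0 * wv w.1 0 + B w.2 i 1 * wv w.1 1) ^ 2 <
          (θ * ‖wv w.1‖) ^ 2 * ((B w.2 0 0 ^ 2 + B w.2 0 1 ^ 2 + (B w.2 1 0 ^ 2 + B w.2 1 1 ^ 2)) / 2)} := by
      rw [Set.setOf_forall]
      refine MeasurableSet.iInter fun i => measurableSet_lt ?_ ?_
      · exact ((((hc2 i 0).mul (hc1' 0)).add ((hc2 i 1).mul (hc1' 1))).pow 2).measurable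
      · exact (((continuous_const.mul hc1.norm).pow 2).mul (hfrob.div_const 2)).measurable
    have : bad = {w | ∀ i, |w.1 i| ≤ R} ∩ ({w | ∀ i, |w.2 i| ≤ R} ∩ {w |
        ∀ i, (B w.2 i 0 * wv w.1 0 + B w.2 i 1 * wv w.1 1) ^ 2 <
          (θ * ‖wv w.1‖) ^ 2 * ((B w.2 0 0 ^ 2 + B w.2 0 1 ^ 2 + (B w.2 1 0 ^ 2 + B w.2 1 1 ^ 2)) / 2)}) := by
      ext w; simp only [hbad, Set.mem_setOf_eq, Set.mem_inter_iff]
    rw [this]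
    exact hbox1.inter (hbox2'.inter hrows)
  have hbad_le : (Px.prod Py) bad ≤ ENNReal.ofReal (C₁ * η) := by
    rw [Measure.prod_apply_symm hbad_m]
    have hsec : ∀ y, Px ((fun x => (x, y)) ⁻¹' bad) ≤ ENNReal.ofReal (C₁ * η) := by
      intro y
      by_cases hy : ∀ i, |y i| ≤ R
      · refine le_trans (measure_mono ?_)
          (pi_two_measure_badRows_le hK0 hK hR hR0 E hv (B y) (hB_det y) hη0 hη8 hηE)
        intro x hx
        simp only [Set.mem_preimage, hbad, Set.mem_setOf_eq] at hx
        refine ⟨hx.1, ?_⟩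
        have h3 := hx.2.2
        simpa only [hwv, hθ, hD] using h3
      · have : (fun x => (x, y)) ⁻¹' bad = ∅ := by
          ext x
          simp only [Set.mem_preimage, hbad, Set.mem_setOf_eq, Set.mem_empty_iff_false, iff_false]
          exact fun hx => hy hx.2.1
        rw [this, measure_empty]
        exact bot_le
    calc ∫⁻ y, Px ((fun x => (x, y)) ⁻¹' bad) ∂Py ≤ ∫⁻ _y, ENNReal.ofReal (C₁ * η) ∂Py :=
          lintegral_mono hsec
      _ = ENNReal.ofReal (C₁ * η) := by rw [lintegral_const]; simp [hPy]
  have hbad_real : (Px.prod Py).real bad ≤ C₁ * η :=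
    ENNReal.toReal_le_of_le_ofReal (by positivity) hbad_le
  -- the two-valued minorant
  set h : (Fin 2 → ℝ) × (Fin q → ℝ) → ℝ := fun w =>
    (Real.log θ - 2 * Λ - Real.log (Real.sqrt 2)) + G w.2 - (2 * (q * Λ)) * bad.indicator 1 w with hh
  have hle : ∀ᵐ w ∂(Px.prod Py), h w ≤ g' w := by
    filter_upwards [hbox] with w hw
    obtain ⟨hx, hy⟩ := hw
    obtain ⟨hw1, hw2⟩ := hw_bounds w.1 hx
    obtain ⟨hG0, hGq⟩ := hG_bounds w.2 hy
    have hD2 : (0 : ℝ) < (D + 1) ^ 2 := by positivity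
    have hwpos : 0 < ‖wv w.1‖ := by
      by_contra h0; rw [not_lt] at h0
      have : ‖wv w.1‖ = 0 := le_antisymm h0 (norm_nonneg _)
      rw [this, mul_zero] at hw2; exact absurd hw2 (by norm_num)
    have hwne : wv w.1 ≠ 0 := norm_pos_iff.mp hwpos
    by_cases hb : w ∈ bad
    · simp only [hh, Set.indicator_of_mem hb, Pi.one_apply, mul_one]
      have := (hg'_bound w hx hy).1
      show _ ≤ g' w
      nlinarith
    · simp only [hh, Set.indicator_of_notMem hb, mul_zero, sub_zero]
      have hex : ∃ i, ¬ ((B w.2 i 0 * wv w.1 0 + B w.2 i 1 * wv w.1 1) ^ 2 <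
          (θ * ‖wv w.1‖) ^ 2 * ((B w.2 0 0 ^ 2 + B w.2 0 1 ^ 2 + (B w.2 1 0 ^ 2 + B w.2 1 1 ^ 2)) / 2)) := by
        by_contra hall
        exact hb ⟨hx, hy, fun i => not_not.mp (not_exists.mp hall i)⟩
      obtain ⟨i, hi⟩ := hex
      rw [not_lt] at hi
      have hgood := log_norm_apply_ge_of_row (B w.2) (hB_det w.2) hwne hθpos i hi
      have hlogw : -(2 * Λ) ≤ Real.log ‖wv w.1‖ := by
        have h1 : ((D + 1) ^ 2)⁻¹ ≤ ‖wv w.1‖ := by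
          rw [inv_le_iff_one_le_mul₀ hD2, mul_comm]; exact hw2
        calc -(2 * Λ) = Real.log (((D + 1) ^ 2)⁻¹) := by rw [Real.log_inv, Real.log_pow]; push_cast; ring
          _ ≤ _ := Real.log_le_log (by positivity) h1
      show _ ≤ g' w
      simp only [hg', hG] at hgood ⊢
      linarith
  have hindi : Integrable (bad.indicator (1 : (Fin 2 → ℝ) × (Fin q → ℝ) → ℝ)) (Px.prod Py) :=
    (integrable_const (1 : ℝ)).indicator hbad_m
  have hsum_i : Integrable (fun w : (Fin 2 → ℝ) × (Fin q → ℝ) =>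
      (Real.log θ - 2 * Λ - Real.log (Real.sqrt 2)) + G w.2) (Px.prod Py) := (integrable_const _).add hGi
  have hpen_i : Integrable (fun w : (Fin 2 → ℝ) × (Fin q → ℝ) => (2 * (q * Λ)) * bad.indicator 1 w) (Px.prod Py) :=
    hindi.const_mul _
  have hhi : Integrable h (Px.prod Py) := hsum_i.sub hpen_i
  have hinth : ∫ w, h w ∂(Px.prod Py) = (Real.log θ - 2 * Λ - Real.log (Real.sqrt 2)) +
      ∫ w, G w.2 ∂(Px.prod Py) - 2 * (q * Λ) * (Px.prod Py).real bad := by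
    have e1 : ∫ w, h w ∂(Px.prod Py) =
        ∫ w, ((Real.log θ - 2 * Λ - Real.log (Real.sqrt 2)) + G w.2) ∂(Px.prod Py) -
          ∫ w, (2 * (q * Λ)) * bad.indicator 1 w ∂(Px.prod Py) := integral_sub hsum_i hpen_i
    have e2 : ∫ w, ((Real.log θ - 2 * Λ - Real.log (Real.sqrt 2)) + G w.2) ∂(Px.prod Py) =
        ∫ _w, (Real.log θ - 2 * Λ - Real.log (Real.sqrt 2)) ∂(Px.prod Py) + ∫ w, G w.2 ∂(Px.prod Py) :=
      integral_add (integrable_const _) hGi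
    have e3 : ∫ w, (2 * (q * Λ)) * bad.indicator 1 w ∂(Px.prod Py) = 2 * (q * Λ) * (Px.prod Py).real bad := by
      rw [integral_const_mul, integral_indicator_one hbad_m]
    rw [e1, e2, e3, integral_const]
    simp
  have hGint : ∫ w, G w.2 ∂(Px.prod Py) = ∫ y, G y ∂Py := by
    rw [integral_fun_snd]; simp
  have hGge : (q : ℝ) * andersonLyapunov μ E ≤ ∫ y, G y ∂Py := mul_andersonLyapunov_le_integral μ E hq
  have hqΛ : 0 ≤ 2 * (q * Λ) := by positivity
  calc (q : ℝ) * andersonLyapunov μ E - 4 * Real.log (|E| + R + 1) + 3 * Real.log η - Real.log (Real.sqrt 2)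
        - 2 * (q * Real.log (|E| + R + 1)) * ((2 * K + 24 * K * (1 + |E| + R)) * η)
        = (Real.log θ - 2 * Λ - Real.log (Real.sqrt 2)) + q * andersonLyapunov μ E
            - 2 * (q * Λ) * (C₁ * η) := by
          rw [hlogθ, hΛ, hD, hC₁]; ring
    _ ≤ (Real.log θ - 2 * Λ - Real.log (Real.sqrt 2)) + ∫ w, G w.2 ∂(Px.prod Py)
            - 2 * (q * Λ) * (Px.prod Py).real bad := by
          rw [hGint]
          have := mul_le_mul_of_nonneg_left hbad_real hqΛ
          linarith
    _ = ∫ w, h w ∂(Px.prod Py) := hinth.symm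
    _ ≤ ∫ w, g' w ∂(Px.prod Py) := integral_mono_ae hhi hg'i hle

/-- `log X ≤ ε X - 1 - log ε` for `X, ε > 0` (from `log (εX) ≤ εX - 1`). [folklore] -/
theorem log_le_mul_sub (X ε : ℝ) (hX : 0 < X) (hε : 0 < ε) : Real.log X ≤ ε * X - 1 - Real.log ε := by
  have h := Real.log_le_sub_one_of_pos (mul_pos hε hX)
  rw [Real.log_mul hε.ne' hX.ne'] at h
  linarith

/-- **Uniform growth of every vector from positivity of the Lyapunov exponent.** If the
single-site law has a bounded density (`μ[p,q] ≤ K(q-p)`) and compact support (`|x| ≤ R` a.s.) and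
`L(E) > 0`, then there is a scale `N ≥ 1` with `𝔼 log ‖M_N^E v‖ ≥ 2` for EVERY unit vector `v`.
This is the "pointwise core" through which Fürstenberg positivity enters negative-moment /
transport bounds; no large-deviation theorem and no uniqueness of the stationary measure is
used. [folklore] -/
theorem exists_scale_logMoment_ge_two {μ : Measure ℝ} [IsProbabilityMeasure μ] {K R : ℝ} (hK0 : 0 ≤ K)
    (hK : ∀ p q : ℝ, μ (Set.Icc p q) ≤ ENNReal.ofReal (K * (q - p)))
    (hR : ∀ᵐ x ∂μ, |x| ≤ R) (hR0 : 0 ≤ R) (E : ℝ) (hL : 0 < andersonLyapunov μ E) :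
    ∃ N : ℕ, 1 ≤ N ∧ ∀ v : EuclideanSpace ℝ (Fin 2), ‖v‖ = 1 →
      2 ≤ ∫ α, Real.log ‖Matrix.toEuclideanLin (andersonTransferProd E (padSeq α) N) v‖
        ∂(Measure.pi fun _ : Fin N => μ) := by
  set L : ℝ := andersonLyapunov μ E with hLdef
  set Λ : ℝ := Real.log (|E| + R + 1) with hΛ
  have hΛ0 : 0 ≤ Λ := Real.log_nonneg (by linarith [abs_nonneg E])
  set C₁ : ℝ := 2 * K + 24 * K * (1 + |E| + R) with hC₁
  have hC₁0 : 0 ≤ C₁ := by positivity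
  set A : ℝ := 1 + |E| + R with hA
  have hA1 : 1 ≤ A := by rw [hA]; linarith [abs_nonneg E]
  set θ₀ : ℝ := min (1 / 8) (1 / (2 * A)) with hθ₀
  have hθ₀pos : 0 < θ₀ := lt_min (by norm_num) (by positivity)
  have hθ₀8 : θ₀ ≤ 1 / 8 := min_le_left _ _
  have hθ₀A : θ₀ * (2 * A) ≤ 1 := by
    have : θ₀ ≤ 1 / (2 * A) := min_le_right _ _
    rwa [le_div_iff₀ (by positivity)] at this
  set ε : ℝ := L / (24 * Λ * C₁ + 24) with hε
  have hεpos : 0 < ε := by positivity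
  have hε24 : ε * (24 * Λ * C₁) ≤ L := by
    have : ε * (24 * Λ * C₁ + 24) = L := by rw [hε]; field_simp
    nlinarith [hεpos]
  set Cst : ℝ := 4 * Λ - 3 * Real.log θ₀ + 3 * ε - 3 - 3 * Real.log ε + Real.log (Real.sqrt 2) + 1 / 2
    with hCst
  -- the scale
  set q : ℕ := ⌈(2 + |Cst|) * 2 / L⌉₊ + 1 with hq
  have hq1 : 1 ≤ q := by omega
  have hqreal : (2 + |Cst|) * 2 / L ≤ (q : ℝ) := by
    rw [hq]; push_cast; linarith [Nat.le_ceil ((2 + |Cst|) * 2 / L)]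
  have hqL : 2 + |Cst| ≤ q * L / 2 := by
    rw [div_le_iff₀ hL] at hqreal; linarith
  have hqpos : (0 : ℝ) < q := by exact_mod_cast hq1
  -- the smoothing parameter
  set X : ℝ := 4 * q * Λ * C₁ + 1 with hX
  have hXpos : 0 < X := by positivity
  have hX1 : 1 ≤ X := by rw [hX]; linarith [show (0:ℝ) ≤ 4 * q * Λ * C₁ by positivity]
  set η : ℝ := θ₀ / X with hη
  have hηpos : 0 < η := by positivity
  have hηθ₀ : η ≤ θ₀ := div_le_self hθ₀pos.le hX1
  have hη8 : η ≤ 1 / 8 := hηθ₀.trans hθ₀8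
  have hηA : η * (2 * (1 + |E| + R)) ≤ 1 := le_trans (by rw [← hA]; gcongr) hθ₀A
  have hpen : 2 * (q * Λ) * (C₁ * η) ≤ 1 / 2 := by
    -- 2qΛC₁ θ₀/X ≤ θ₀/2 ≤ 1/2
    have h1 : 2 * (q * Λ) * (C₁ * η) = θ₀ * ((2 * q * Λ * C₁) / X) := by rw [hη]; ring
    have h2 : (2 * q * Λ * C₁) / X ≤ 1 / 2 := by
      rw [div_le_iff₀ hXpos, hX]; linarith [show (0:ℝ) ≤ q * Λ * C₁ by positivity]
    have h3 : θ₀ ≤ 1 := by linarith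
    calc 2 * (q * Λ) * (C₁ * η) = θ₀ * ((2 * q * Λ * C₁) / X) := h1
      _ ≤ 1 * (1 / 2) := mul_le_mul h3 h2 (by positivity) zero_le_one
      _ = 1 / 2 := one_mul _
  have hlogη : 3 * Real.log θ₀ - q * L / 2 - 3 * ε + 3 + 3 * Real.log ε ≤ 3 * Real.log η := by
    have h1 : Real.log η = Real.log θ₀ - Real.log X := by rw [hη, Real.log_div hθ₀pos.ne' hXpos.ne']
    have h2 : Real.log X ≤ ε * X - 1 - Real.log ε := log_le_mul_sub X ε hXpos hεpos
    have h3 : ε * X ≤ q * L / 6 + ε := by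
      have e : ε * X = (q / 6) * (ε * (24 * Λ * C₁)) + ε := by rw [hX]; ring
      have : (q / 6) * (ε * (24 * Λ * C₁)) ≤ (q / 6) * L :=
        mul_le_mul_of_nonneg_left hε24 (by positivity)
      rw [e]; linarith
    linarith
  refine ⟨2 + q, by omega, fun v hv => ?_⟩
  have hmain := integral_log_norm_apply_ge hK0 hK hR hR0 E hq1 hηpos hη8 hηA hv
  have habs : Cst ≤ |Cst| := le_abs_self Cst
  -- assemble
  have : (2 : ℝ) ≤ (q : ℝ) * L - 4 * Λ + 3 * Real.log η - Real.log (Real.sqrt 2)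
      - 2 * (q * Λ) * (C₁ * η) := by
    linarith
  exact this.trans hmain

end Literature.Probability.RandomMatrixProducts

end
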